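import Summits.CriticalPhenomena.SAWScalingLimit.Theorems.SAWDevelopingMapObservableToSLETypeLadderCarvedReductionSqueezeCells
import Summits.CriticalPhenomena.SAWScalingLimit.Theorems.SAWDevelopingMapObservableToSLETypeLadderCarvedReductionSqueezeThresholds
import Summits.CriticalPhenomena.SAWScalingLimit.Theorems.SAWDevelopingMapObservableToSLETypeLadderCarvedReductionSqueezeHexagons
import HarnessLib

/-!
# The pinned window: present vertices fill the open upper half-ball, removed ones sink below the
# gate line, persistently removed sets stay `ρ/4` off it (piece (T-A′ gate) of stub T-A′
# `stub_carvedReduction_squeezeGeometry_domains`)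

Crux `SAWDevelopingMap.ObservableToSLE` (stmt-CriticalPhenomena-10472), line `six-class-type-ladder`,
stub T-A′ `stub_carvedReduction_squeezeGeometry_domains`.  Landing target:
`Summits/CriticalPhenomena/SAWScalingLimit/Theorems/SAWDevelopingMapObservableToSLETypeLadderCarvedReductionSqueezeGateHalfBall.lean`
(`--supports stmt-CriticalPhenomena-10472`; registered carrier `stub_carvedReduction_gateHalfBall`).

In the pinned frame `π_j v = s_j c_v - s_j · triEmbed x_j` of STAGE 1a
(`carvedReduction_squeezeGeometry_selection`, p137830) the realised window at a gate `P` is EXACT: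
eventually, for every vertex `v` with `π_j v ∈ ball P r`, `v` is removed iff its row is below the
gate row (`v ∈ U_j ↔ v.1 1 < (q_j).1 1`), the pinned gate `q̃_j = s_j c_{(q_j.1 - x_j, 0)} → P`
strictly from above.  This file turns that into the continuum geometry every later piece uses
(corridors off the bulk, flatness of the limit bulk, the link, the reach clause):

* `gate_present_above` / `gate_removed_below` — eventually, present vertices of the window lie on
  or above the pinned gate height (hence strictly above the line `im = im P`), removed ones
  strictly below it;
* `gate_exists_present_near` — every point of the open upper half-ball is, eventually, within
  `2 s_j` of (and below) a PRESENT pinned vertex of the window;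
* `gate_le_dist_of_persistent` — a set `B` whose `(m - ε)`-neighbourhoods are persistently
  removed (the limit bodies, `m = ρ/4`; the limit spines, `m = ρ/8`) stays at distance `≥ m`
  from the open upper half-ball;
* `gate_not_mem_of_tendsto_removed` — limits of removed pinned vertices avoid the open upper
  half-ball; `gate_hexagon_interior_disjoint` — so do the interiors of persistently removed
  limit hexagons (skew coordinates);
* `stub_carvedReduction_gateHalfBall` — registered packaging of the first three items.
-/

noncomputable section

open scoped Topology
open Filter Set Metric
open Literature.Probability.LatticeModels (HexVertex hexGraph hexCenter triZeta triEmbed Site)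
open Literature.Probability.RandomPlanarGeometry
open Literature.Probability.RandomPlanarGeometry.SAW

namespace Summit.CriticalPhenomena.SAWScalingLimit.Theorems.ObservableToSLE.TypeLadder

open Summit.CriticalPhenomena.SAWScalingLimit.Theorems.ObservableToSLE.FloorRatio (row_le_iff_im im_smul_hexCenter)
open Summit.CriticalPhenomena.SAWScalingLimit.Theorems.ObservableToSLER.BridgeGate

section Gate

variable {s : ℕ → ℝ} {x : ℕ → Site 2} {U : ℕ → Set HexVertex} {q : ℕ → HexVertex} {P : ℂ} {r : ℝ}

/-- The pinned centre is the rescaled centre of the vertex translated back by `x`. -/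
theorem pinned_eq_translate (t : ℝ) (y : Site 2) (v : HexVertex) :
    (t : ℂ) * hexCenter v - (t : ℂ) * triEmbed y = (t : ℂ) * hexCenter ((-y + v.1, v.2) : HexVertex) :=
  (smul_hexCenter_neg_translate t y v).symm

/-- The pinned gate `s c_{(q.1 - x, 0)}` is the pinned centre of `q` (a vertex of type `0`). -/
theorem pinnedGate_eq (t : ℝ) (y : Site 2) {w : HexVertex} (hw : w.2 = 0) :
    (t : ℂ) * hexCenter ((w.1 - y, 0) : HexVertex) = (t : ℂ) * hexCenter w - (t : ℂ) * triEmbed y := by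
  rw [pinned_eq_translate, sub_eq_neg_add, ← hw]

/-- **Present vertices of the window are not below the pinned gate height** (eventually). -/
theorem gate_present_above (hs : ∀ j, 0 < s j)
    (hU : ∀ᶠ j in atTop, ∀ v : HexVertex,
      (s j : ℂ) * hexCenter v - (s j : ℂ) * triEmbed (x j) ∈ ball P r → (v ∈ U j ↔ v.1 1 < (q j).1 1)) :
    ∀ᶠ j in atTop, ∀ v : HexVertex, (s j : ℂ) * hexCenter v - (s j : ℂ) * triEmbed (x j) ∈ ball P r →
      v ∉ U j → ((s j : ℂ) * hexCenter (((q j).1 - x j, 0) : HexVertex)).im ≤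
        ((s j : ℂ) * hexCenter v - (s j : ℂ) * triEmbed (x j)).im := by
  filter_upwards [hU] with j hj v hv hvU
  have hrow : (q j).1 1 ≤ v.1 1 := not_lt.1 fun h => hvU ((hj v hv).2 h)
  rw [pinned_eq_translate]
  have key := (row_le_iff_im (hs j) ((((q j).1 - x j, (0 : Fin 2)) : HexVertex).1 1)
    ((-(x j) + v.1, v.2) : HexVertex)).1 (by
      show ((q j).1 - x j) 1 ≤ (-(x j) + v.1) 1
      simp only [Pi.sub_apply, Pi.add_apply, Pi.neg_apply]; linarith)
  rwa [← im_smul_hexCenter_upFace (s j) ((q j).1 - x j)] at key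

/-- **Removed vertices of the window lie strictly below the pinned gate height** (eventually). -/
theorem gate_removed_below (hs : ∀ j, 0 < s j)
    (hU : ∀ᶠ j in atTop, ∀ v : HexVertex,
      (s j : ℂ) * hexCenter v - (s j : ℂ) * triEmbed (x j) ∈ ball P r → (v ∈ U j ↔ v.1 1 < (q j).1 1)) :
    ∀ᶠ j in atTop, ∀ v : HexVertex, (s j : ℂ) * hexCenter v - (s j : ℂ) * triEmbed (x j) ∈ ball P r →
      v ∈ U j → ((s j : ℂ) * hexCenter v - (s j : ℂ) * triEmbed (x j)).im <
        ((s j : ℂ) * hexCenter (((q j).1 - x j, 0) : HexVertex)).im := by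
  filter_upwards [hU] with j hj v hv hvU
  have hrow : v.1 1 < (q j).1 1 := (hj v hv).1 hvU
  rw [pinned_eq_translate, im_smul_hexCenter_upFace]
  have h1 : ((-(x j) + v.1, v.2) : HexVertex).1 1 < ((q j).1 - x j) 1 := by
    show (-(x j) + v.1) 1 < ((q j).1 - x j) 1
    simp only [Pi.sub_apply, Pi.add_apply, Pi.neg_apply]; linarith
  exact im_lt_of_row_lt (hs j) h1

/-- **Every point of the open upper half-ball is eventually within `2 s_j` of, and below, a
present pinned vertex of the window.** -/
theorem gate_exists_present_near (hs : ∀ j, 0 < s j) (hs0 : Tendsto s atTop (𝓝 0))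
    (hconv : Tendsto (fun j => (s j : ℂ) * hexCenter (((q j).1 - x j, 0) : HexVertex)) atTop (𝓝 P))
    (hU : ∀ᶠ j in atTop, ∀ v : HexVertex,
      (s j : ℂ) * hexCenter v - (s j : ℂ) * triEmbed (x j) ∈ ball P r → (v ∈ U j ↔ v.1 1 < (q j).1 1))
    {z : ℂ} (hz : dist z P < r) (hzim : P.im < z.im) :
    ∀ᶠ j in atTop, ∃ v : HexVertex, v ∉ U j ∧
      (s j : ℂ) * hexCenter v - (s j : ℂ) * triEmbed (x j) ∈ ball P r ∧
      dist ((s j : ℂ) * hexCenter v - (s j : ℂ) * triEmbed (x j)) z ≤ 2 * s j ∧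
      z.im < ((s j : ℂ) * hexCenter v - (s j : ℂ) * triEmbed (x j)).im := by
  -- eventually `2 s_j < r - dist z P` and `im q̃_j < im z`
  have h1 : ∀ᶠ j in atTop, 2 * s j < r - dist z P := by
    have : Tendsto (fun j => 2 * s j) atTop (𝓝 (2 * 0)) := hs0.const_mul 2
    rw [mul_zero] at this
    exact this.eventually (gt_mem_nhds (by linarith))
  have h2 : ∀ᶠ j in atTop, ((s j : ℂ) * hexCenter (((q j).1 - x j, 0) : HexVertex)).im < z.im :=
    (Complex.continuous_im.tendsto P |>.comp hconv).eventually (gt_mem_nhds hzim)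
  filter_upwards [h1, h2, hU] with j hj1 hj2 hj
  -- an up-face just above the moving target `z + s_j · triEmbed x_j`
  obtain ⟨g, hg1, hg2, hg3, -⟩ := exists_upFace_near (z + (s j : ℂ) * triEmbed (x j))
  set v : HexVertex := (g (s j), 0) with hv
  have him1 := hg1 (s j) (hs j)
  have him2 := hg2 (s j) (hs j)
  have hre := hg3 (s j) (hs j)
  simp only [Complex.add_im, Complex.add_re] at him1 him2 hre
  have hπim : ((s j : ℂ) * hexCenter v - (s j : ℂ) * triEmbed (x j)).im =
      ((s j : ℂ) * hexCenter v).im - ((s j : ℂ) * triEmbed (x j)).im := by simp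
  have hπre : ((s j : ℂ) * hexCenter v - (s j : ℂ) * triEmbed (x j)).re =
      ((s j : ℂ) * hexCenter v).re - ((s j : ℂ) * triEmbed (x j)).re := by simp
  have hzim' : z.im < ((s j : ℂ) * hexCenter v - (s j : ℂ) * triEmbed (x j)).im := by
    rw [hπim]; linarith
  have hdist : dist ((s j : ℂ) * hexCenter v - (s j : ℂ) * triEmbed (x j)) z ≤ 2 * s j := by
    refine (dist_le_abs_re_add_abs_im _ _).trans ?_
    rw [Complex.sub_re, Complex.sub_im, hπre, hπim]
    have e1 : |((s j : ℂ) * hexCenter v).re - ((s j : ℂ) * triEmbed (x j)).re - z.re| ≤ s j := by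
      rw [show ((s j : ℂ) * hexCenter v).re - ((s j : ℂ) * triEmbed (x j)).re - z.re =
        ((s j : ℂ) * hexCenter v).re - (z.re + ((s j : ℂ) * triEmbed (x j)).re) by ring]
      exact hre
    have e2 : |((s j : ℂ) * hexCenter v).im - ((s j : ℂ) * triEmbed (x j)).im - z.im| ≤ s j := by
      rw [abs_le]; constructor <;> linarith
    linarith
  have hball : (s j : ℂ) * hexCenter v - (s j : ℂ) * triEmbed (x j) ∈ ball P r := by
    rw [mem_ball]
    calc dist ((s j : ℂ) * hexCenter v - (s j : ℂ) * triEmbed (x j)) P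
        ≤ dist ((s j : ℂ) * hexCenter v - (s j : ℂ) * triEmbed (x j)) z + dist z P := dist_triangle _ _ _
      _ < r := by linarith
  refine ⟨v, fun hvU => ?_, hball, hdist, hzim'⟩
  -- a removed vertex would be below the pinned gate height
  have hrow : v.1 1 < (q j).1 1 := (hj v hball).1 hvU
  have h3 : ((-(x j) + v.1, v.2) : HexVertex).1 1 < ((q j).1 - x j) 1 := by
    show (-(x j) + v.1) 1 < ((q j).1 - x j) 1
    simp only [Pi.sub_apply, Pi.add_apply, Pi.neg_apply]; linarith
  have hlt := im_lt_of_row_lt (hs j) h3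
  rw [← pinned_eq_translate, ← im_smul_hexCenter_upFace (s j) ((q j).1 - x j)] at hlt
  linarith

/-- **Persistently removed neighbourhoods stay off the open upper half-ball**: if, for every
`ε > 0`, eventually every vertex whose pinned centre is within `m - ε` of `B` is removed, then
every point of `B` is at distance `≥ m` from every point of the open upper half-ball of the
window. -/
theorem gate_le_dist_of_persistent (hs : ∀ j, 0 < s j) (hs0 : Tendsto s atTop (𝓝 0))
    (hconv : Tendsto (fun j => (s j : ℂ) * hexCenter (((q j).1 - x j, 0) : HexVertex)) atTop (𝓝 P))
    (hU : ∀ᶠ j in atTop, ∀ v : HexVertex,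
      (s j : ℂ) * hexCenter v - (s j : ℂ) * triEmbed (x j) ∈ ball P r → (v ∈ U j ↔ v.1 1 < (q j).1 1))
    {B : Set ℂ} {m : ℝ}
    (hper : ∀ ε > (0 : ℝ), ∀ᶠ j in atTop, ∀ v : HexVertex,
      infDist ((s j : ℂ) * hexCenter v - (s j : ℂ) * triEmbed (x j)) B ≤ m - ε → v ∈ U j)
    {b : ℂ} (hb : b ∈ B) {z : ℂ} (hz : dist z P < r) (hzim : P.im < z.im) : m ≤ dist b z := by
  by_contra hlt
  push Not at hlt
  set ε : ℝ := (m - dist b z) / 4 with hε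
  have hε0 : 0 < ε := by rw [hε]; linarith
  have h1 : ∀ᶠ j in atTop, 2 * s j < ε := by
    have : Tendsto (fun j => 2 * s j) atTop (𝓝 (2 * 0)) := hs0.const_mul 2
    rw [mul_zero] at this
    exact this.eventually (gt_mem_nhds hε0)
  obtain ⟨j, ⟨v, hvU, -, hvz, -⟩, hj1, hj2⟩ :=
    ((gate_exists_present_near hs hs0 hconv hU hz hzim).and (h1.and (hper ε hε0))).exists
  refine hvU (hj2 v ?_)
  calc infDist ((s j : ℂ) * hexCenter v - (s j : ℂ) * triEmbed (x j)) B
      ≤ dist ((s j : ℂ) * hexCenter v - (s j : ℂ) * triEmbed (x j)) b := infDist_le_dist_of_mem hb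
    _ ≤ dist ((s j : ℂ) * hexCenter v - (s j : ℂ) * triEmbed (x j)) z + dist z b := dist_triangle _ _ _
    _ ≤ m - ε := by rw [dist_comm z b]; linarith

/-- **Limits of removed pinned vertices avoid the open upper half-ball.** -/
theorem gate_not_mem_of_tendsto_removed (hs : ∀ j, 0 < s j)
    (hconv : Tendsto (fun j => (s j : ℂ) * hexCenter (((q j).1 - x j, 0) : HexVertex)) atTop (𝓝 P))
    (hU : ∀ᶠ j in atTop, ∀ v : HexVertex,
      (s j : ℂ) * hexCenter v - (s j : ℂ) * triEmbed (x j) ∈ ball P r → (v ∈ U j ↔ v.1 1 < (q j).1 1))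
    {t : ℕ → HexVertex} (ht : ∀ᶠ j in atTop, t j ∈ U j) {C : ℂ}
    (hC : Tendsto (fun j => (s j : ℂ) * hexCenter (t j) - (s j : ℂ) * triEmbed (x j)) atTop (𝓝 C))
    (hCr : dist C P < r) : C.im ≤ P.im := by
  by_contra hlt
  push Not at hlt
  have h1 : ∀ᶠ j in atTop, (s j : ℂ) * hexCenter (t j) - (s j : ℂ) * triEmbed (x j) ∈ ball P r :=
    hC.eventually (isOpen_ball.mem_nhds (mem_ball.2 hCr))
  have h2 : ∀ᶠ j in atTop, (C.im + P.im) / 2 < ((s j : ℂ) * hexCenter (t j) - (s j : ℂ) * triEmbed (x j)).im :=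
    (Complex.continuous_im.tendsto C |>.comp hC).eventually (lt_mem_nhds (by linarith))
  have h3 : ∀ᶠ j in atTop, ((s j : ℂ) * hexCenter (((q j).1 - x j, 0) : HexVertex)).im < (C.im + P.im) / 2 :=
    (Complex.continuous_im.tendsto P |>.comp hconv).eventually (gt_mem_nhds (by linarith))
  obtain ⟨j, hj1, hj2, hj3, hj4, hj5⟩ := (h1.and (h2.and (h3.and (ht.and (gate_removed_below hs hU))))).exists
  have := hj5 (t j) hj1 hj4
  linarith

/-- **Interiors of persistently removed limit hexagons avoid the open upper half-ball**: if the
`ε`-shrunken hexagon `{∀ ℓ, |skewCoord ℓ (· - C)| ≤ ϱ - ε}` is eventually removed for every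
`ε > 0`, no point `z` with `|skewCoord ℓ (z - C)| < ϱ` for all `ℓ` lies in the open upper
half-ball. -/
theorem gate_hexagon_interior_disjoint (hs : ∀ j, 0 < s j) (hs0 : Tendsto s atTop (𝓝 0))
    (hconv : Tendsto (fun j => (s j : ℂ) * hexCenter (((q j).1 - x j, 0) : HexVertex)) atTop (𝓝 P))
    (hU : ∀ᶠ j in atTop, ∀ v : HexVertex,
      (s j : ℂ) * hexCenter v - (s j : ℂ) * triEmbed (x j) ∈ ball P r → (v ∈ U j ↔ v.1 1 < (q j).1 1))
    {C : ℂ} {ϱ : ℝ}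
    (hper : ∀ ε > (0 : ℝ), ∀ᶠ j in atTop, ∀ v : HexVertex,
      (∀ ℓ : Fin 3, |skewCoord ℓ ((s j : ℂ) * hexCenter v - (s j : ℂ) * triEmbed (x j) - C)| ≤ ϱ - ε) → v ∈ U j)
    {z : ℂ} (hzC : ∀ ℓ : Fin 3, |skewCoord ℓ (z - C)| < ϱ) (hz : dist z P < r) (hzim : P.im < z.im) : False := by
  -- a uniform margin
  set M : ℝ := max (max |skewCoord 0 (z - C)| |skewCoord 1 (z - C)|) |skewCoord 2 (z - C)| with hM
  have hMϱ : M < ϱ := max_lt (max_lt (hzC 0) (hzC 1)) (hzC 2)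
  have hMℓ : ∀ ℓ : Fin 3, |skewCoord ℓ (z - C)| ≤ M := by
    intro ℓ; fin_cases ℓ
    · exact (le_max_left _ _).trans (le_max_left _ _)
    · exact (le_max_right _ _).trans (le_max_left _ _)
    · exact le_max_right _ _
  set ε : ℝ := (ϱ - M) / 2 with hε
  have hε0 : 0 < ε := by rw [hε]; linarith
  have h1 : ∀ᶠ j in atTop, 2 * (2 * s j) < ε := by
    have : Tendsto (fun j => 2 * (2 * s j)) atTop (𝓝 (2 * (2 * 0))) := (hs0.const_mul 2).const_mul 2
    rw [mul_zero, mul_zero] at this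
    exact this.eventually (gt_mem_nhds hε0)
  obtain ⟨j, ⟨v, hvU, -, hvz, -⟩, hj1, hj2⟩ :=
    ((gate_exists_present_near hs hs0 hconv hU hz hzim).and (h1.and (hper ε hε0))).exists
  refine hvU (hj2 v fun ℓ => ?_)
  set w : ℂ := (s j : ℂ) * hexCenter v - (s j : ℂ) * triEmbed (x j) with hw
  have hsplit : skewCoord ℓ (w - C) = skewCoord ℓ (z - C) + skewCoord ℓ (w - z) := by
    rw [← skewCoord_add]; congr 1; ring
  have hbound : |skewCoord ℓ (w - z)| ≤ 2 * dist w z := by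
    rw [dist_eq_norm]; exact abs_skewCoord_le ℓ (w - z)
  rw [hsplit]
  refine (abs_add_le _ _).trans ?_
  linarith [hMℓ ℓ]


/-- **Registered carrier `stub_carvedReduction_gateHalfBall`** (crux item stmt-CriticalPhenomena-10472,
stub T-A′ `stub_carvedReduction_squeezeGeometry_domains`, piece THE PINNED WINDOW): from the
exactness of the realised window in the pinned frame — present vertices of the window lie
strictly above the gate line, every point of the open upper half-ball is eventually `2 s_j`-close
to a present vertex, persistently removed neighbourhoods stay `m` off the open upper half-ball,
and limits of removed vertices are not above the line. -/
theorem stub_carvedReduction_gateHalfBall :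
    ∀ (s : ℕ → ℝ) (x : ℕ → Site 2) (U : ℕ → Set HexVertex) (q : ℕ → HexVertex) (P : ℂ) (r : ℝ),
      (∀ j, 0 < s j) → Tendsto s atTop (𝓝 0) →
      Tendsto (fun j => (s j : ℂ) * hexCenter (((q j).1 - x j, 0) : HexVertex)) atTop (𝓝 P) →
      (∀ j, P.im < ((s j : ℂ) * hexCenter (((q j).1 - x j, 0) : HexVertex)).im) →
      (∀ᶠ j in atTop, ∀ v : HexVertex, (s j : ℂ) * hexCenter v - (s j : ℂ) * triEmbed (x j) ∈ ball P r →
        (v ∈ U j ↔ v.1 1 < (q j).1 1)) →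
      (∀ᶠ j in atTop, ∀ v : HexVertex, (s j : ℂ) * hexCenter v - (s j : ℂ) * triEmbed (x j) ∈ ball P r →
        v ∉ U j → P.im < ((s j : ℂ) * hexCenter v - (s j : ℂ) * triEmbed (x j)).im) ∧
      (∀ z : ℂ, dist z P < r → P.im < z.im → ∀ᶠ j in atTop, ∃ v : HexVertex, v ∉ U j ∧
        (s j : ℂ) * hexCenter v - (s j : ℂ) * triEmbed (x j) ∈ ball P r ∧
        dist ((s j : ℂ) * hexCenter v - (s j : ℂ) * triEmbed (x j)) z ≤ 2 * s j) ∧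
      (∀ (B : Set ℂ) (m : ℝ), (∀ ε > (0 : ℝ), ∀ᶠ j in atTop, ∀ v : HexVertex,
          infDist ((s j : ℂ) * hexCenter v - (s j : ℂ) * triEmbed (x j)) B ≤ m - ε → v ∈ U j) →
        ∀ b ∈ B, ∀ z : ℂ, dist z P < r → P.im < z.im → m ≤ dist b z) ∧
      (∀ (t : ℕ → HexVertex) (C : ℂ), (∀ᶠ j in atTop, t j ∈ U j) →
        Tendsto (fun j => (s j : ℂ) * hexCenter (t j) - (s j : ℂ) * triEmbed (x j)) atTop (𝓝 C) →
        dist C P < r → C.im ≤ P.im) := by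
  intro s x U q P r hs hs0 hconv habove hU
  refine ⟨?_, fun z hz hzim => ?_, fun B m hper b hb z hz hzim => gate_le_dist_of_persistent hs hs0 hconv hU hper hb hz hzim,
    fun t C ht hC hCr => gate_not_mem_of_tendsto_removed hs hconv hU ht hC hCr⟩
  · filter_upwards [gate_present_above hs hU] with j hj v hv hvU
    exact (habove j).trans_le (hj v hv hvU)
  · filter_upwards [gate_exists_present_near hs hs0 hconv hU hz hzim] with j hj
    obtain ⟨v, h1, h2, h3, -⟩ := hj
    exact ⟨v, h1, h2, h3⟩

end Gate

end Summit.CriticalPhenomena.SAWScalingLimit.Theorems.ObservableToSLE.TypeLadder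

end
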